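import Literature.Topology.FourManifolds.SurfaceGroupNielsenReduction
import HarnessLib

/-!
# Grigorchuk–Kurchanov with liftable witnesses

Topic `Literature/Topology/FourManifolds`; corollaries of `SurfaceGroupNielsenReduction.lean`
(the Grigorchuk–Kurchanov pipeline re-run keeping track of Nielsen liftability) for the consumers
of `GrigorchukKurchanov1990_stronglyEquivalent` (`SurfaceGroupEpimorphisms.lean`).

The tree proves (Zieschang 1964; Grigorchuk–Kurchanov 1990) that any two epimorphisms
`S_g ↠ F_g` of the genus-`g` surface group onto the free group of rank `g` differ by an
automorphism `γ` of `S_g`.  The automorphism produced by that proof is a composite of automorphisms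
induced by automorphisms of the free group `F⟨a₀, …, b_{g-1}⟩` (Zieschang's engine), cut swaps,
inversion moves and handle slides — all of which are LIFTABLE in the sense of Nielsen's theorem
(`nielsen_surfaceGroup_mulEquiv_lift`: induced by an automorphism `φ` of the free group with
`φ(r_g) = c · r_g^{±1} · c⁻¹`; files `SurfaceGroupLiftableMoves/Slides.lean`).  Hence, WITHOUT
Nielsen's theorem:

* `SurfaceGroup.exists_liftable_comp_eq` — any two epimorphisms `α, β : S_g ↠ F_g` satisfy
  `α ∘ γ = β` for a LIFTABLE automorphism `γ`;
* `SurfaceGroup.exists_liftable_map_eq` — kernel form: two normal subgroups of `S_g` with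
  quotients free of rank `g` are carried onto each other by a LIFTABLE automorphism.

So every re-marking of cut systems / handlebody kernels the tree performs algebraically can be
done by automorphisms to which `TrisectionKernels.iso_stabilize_map_of_lift` applies
unconditionally.

## References

* R. I. Grigorchuk, P. F. Kurchanov, *Classification of epimorphisms from fundamental groups of
  surfaces onto free groups*, Math. Notes 48 (1990). [GrigorchukKurchanov1990]
* H. Zieschang, *Alternierende Produkte in freien Gruppen*, Abh. Math. Sem. Univ. Hamburg 27
  (1964) 13–31. [Zieschang1964]
* H. Zieschang, E. Vogt, H.-D. Coldewey, *Surfaces and Planar Discontinuous Groups*, LNM 835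
  (1980), §5.2, E 5.4, Thm. 5.6.1. [ZieschangVogtColdewey1980]
-/

noncomputable section

namespace Literature.Topology.FourManifolds

namespace SurfaceGroup

variable {g : ℕ}

/-- **Grigorchuk–Kurchanov with a liftable witness.**  Any two epimorphisms
`α, β : S_g ↠ F_g` differ by a LIFTABLE automorphism of `S_g`: `α ∘ γ = β` with `γ` induced by
an automorphism of the free group sending `r_g` to a conjugate of `r_g^{±1}`.  (Both `α` and `β`
are `ν` up to liftable automorphisms: `exists_liftable_forall_apply_a_eq_one`,
`exists_liftable_comp_eq_handlebodyProj`.) [cite: GrigorchukKurchanov1990, main theorem (orientable case, r = g)]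
[cite: ZieschangVogtColdewey1980, §5.2 and E 5.4] -/
theorem exists_liftable_comp_eq (α β : SurfaceGroup g →* FreeGroup (Fin g))
    (hα : Function.Surjective α) (hβ : Function.Surjective β) :
    ∃ γ : SurfaceGroup g ≃* SurfaceGroup g,
      (∃ (φ : FreeGroup (surfaceGen g) ≃* FreeGroup (surfaceGen g)) (c : FreeGroup (surfaceGen g))
        (ε : ℤ), (ε = 1 ∨ ε = -1) ∧ φ (surfaceRelator g) = c * surfaceRelator g ^ ε * c⁻¹ ∧
        ∀ x, PresentedGroup.mk _ (φ x) = γ (PresentedGroup.mk _ x)) ∧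
      α.comp γ.toMonoidHom = β := by
  -- adapted from `stronglyEquivalent_of_forall_exists_apply_a_eq_one`, with liftable pieces
  obtain ⟨γ₁, l₁, h₁⟩ := exists_liftable_forall_apply_a_eq_one α
  obtain ⟨γ₂, l₂, h₂⟩ := exists_liftable_forall_apply_a_eq_one β
  obtain ⟨δ₁, m₁, e₁⟩ := exists_liftable_comp_eq_handlebodyProj (α.comp γ₁.toMonoidHom)
    (hα.comp γ₁.surjective) (fun i => by simpa using h₁ i)
  obtain ⟨δ₂, m₂, e₂⟩ := exists_liftable_comp_eq_handlebodyProj (β.comp γ₂.toMonoidHom)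
    (hβ.comp γ₂.surjective) (fun i => by simpa using h₂ i)
  -- `α γ₁ δ₁ = ν = β γ₂ δ₂`, so `α (γ₁ δ₁ δ₂⁻¹ γ₂⁻¹) = β`
  refine ⟨((γ₂.symm.trans δ₂.symm).trans δ₁).trans γ₁, ?_, MonoidHom.ext fun x => ?_⟩
  · exact liftable_trans (liftable_trans (liftable_trans (liftable_symm l₂) (liftable_symm m₂)) m₁) l₁
  · have f₁ := DFunLike.congr_fun e₁ (δ₂.symm (γ₂.symm x))
    have f₂ := DFunLike.congr_fun e₂ (δ₂.symm (γ₂.symm x))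
    simp only [MonoidHom.coe_comp, MulEquiv.coe_toMonoidHom, Function.comp_apply,
      MulEquiv.apply_symm_apply] at f₁ f₂
    simp only [MonoidHom.coe_comp, MulEquiv.coe_toMonoidHom, Function.comp_apply,
      MulEquiv.trans_apply]
    rw [f₁, ← f₂]

/-- **Kernel form with a liftable witness.**  If `K, K' ⊴ S_g` have quotients free of rank `g`,
some LIFTABLE automorphism of `S_g` carries `K` onto `K'`. [cite: GrigorchukKurchanov1990, main theorem (orientable case, r = g)] -/
theorem exists_liftable_map_eq (K K' : Subgroup (SurfaceGroup g)) [K.Normal] [K'.Normal]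
    (hK : IsFreeOfRank (SurfaceGroup g ⧸ K) g) (hK' : IsFreeOfRank (SurfaceGroup g ⧸ K') g) :
    ∃ α : SurfaceGroup g ≃* SurfaceGroup g,
      (∃ (φ : FreeGroup (surfaceGen g) ≃* FreeGroup (surfaceGen g)) (c : FreeGroup (surfaceGen g))
        (ε : ℤ), (ε = 1 ∨ ε = -1) ∧ φ (surfaceRelator g) = c * surfaceRelator g ^ ε * c⁻¹ ∧
        ∀ x, PresentedGroup.mk _ (φ x) = α (PresentedGroup.mk _ x)) ∧
      K.map α.toMonoidHom = K' := by
  -- adapted from `GrigorchukKurchanov1990_stronglyEquivalent.exists_mulEquiv_map_eq`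
  obtain ⟨α, hαs, hαk⟩ := exists_surjective_ker_eq K hK
  obtain ⟨β, hβs, hβk⟩ := exists_surjective_ker_eq K' hK'
  obtain ⟨γ, hl, hγ⟩ := exists_liftable_comp_eq α β hαs hβs
  refine ⟨γ.symm, liftable_symm hl, ?_⟩
  have key : ∀ z : SurfaceGroup g, z ∈ K' ↔ γ z ∈ K := fun z ↦ by
    rw [← hβk, ← hαk, MonoidHom.mem_ker, MonoidHom.mem_ker, ← hγ]
    simp
  ext x
  rw [Subgroup.mem_map, key]
  constructor
  · rintro ⟨y, hy, rfl⟩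
    simpa using hy
  · intro hx
    exact ⟨γ x, hx, by simp⟩

/-- **Kernel form, one standard kernel.**  A normal subgroup `K ⊴ S_g` with `S_g ⧸ K` free of rank
`g` is the image of the handlebody kernel `ker ν = ⟪a₀, …, a_{g-1}⟫` under a LIFTABLE automorphism
of `S_g`. [cite: GrigorchukKurchanov1990, main theorem (orientable case, r = g)] -/
theorem exists_liftable_map_ker_handlebodyProj_eq (K : Subgroup (SurfaceGroup g)) [K.Normal]
    (hK : IsFreeOfRank (SurfaceGroup g ⧸ K) g) :
    ∃ α : SurfaceGroup g ≃* SurfaceGroup g,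
      (∃ (φ : FreeGroup (surfaceGen g) ≃* FreeGroup (surfaceGen g)) (c : FreeGroup (surfaceGen g))
        (ε : ℤ), (ε = 1 ∨ ε = -1) ∧ φ (surfaceRelator g) = c * surfaceRelator g ^ ε * c⁻¹ ∧
        ∀ x, PresentedGroup.mk _ (φ x) = α (PresentedGroup.mk _ x)) ∧
      (handlebodyProj g).ker.map α.toMonoidHom = K := by
  haveI : (handlebodyProj g).ker.Normal := inferInstance
  refine exists_liftable_map_eq _ K ?_ hK
  exact ⟨(QuotientGroup.quotientKerEquivOfSurjective (handlebodyProj g) handlebodyProj_surjective).symm⟩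

end SurfaceGroup

end Literature.Topology.FourManifolds

end
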